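import Mathlib

/-!
# NE7EJFlatSecularBAllDim — row NE7 (node U5), candidate route HOM, variant H1L-EJ, item EJ-1b′ (T1)–(T3′): THEOREM B's secular criterion IN EVERY
# DIMENSION `d′` — `S_B^{(d′)} = Σ_{n ∈ {0,1}^{d′}} w_n(1 + 2u_n) = Π_μ(1 − 2A_μ) + 2Σ_μ A_μ Π_{ν≠μ}(1 − 2A_ν) ≤ 1` («the probability of at most one
# failure»), with lens 1's `d′ = 2` (`1 − 4AB`) and `d′ = 3` (`1 − 4ΣAB + 16ABC`) displays as instances

Lineage `b2b-balaban-t4-ne7-p2` (CRUX PROVER NE7 #2 = C-HOM°'s kernel hand), generation 82; file 134.  Mathlib-only imports (the `d′ = 2` objects of files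
117 ∕ 128 are `Bool × Bool`-indexed; here the labels are `Fin d′ → Bool`, new objects, nothing restated).

SOURCE (lens 1 = `t4-ne7-idea-1` gen 73, toy P-EJ-15 (ii), `t4/ideate/NE7/lens1-g73/FLATPADE-NOTE.md` d2ccf99438315edd; [NE7IDEA1-G73-INBOX] L.53664):
«THEOREM B … 1 − S = 4AB … (h = 1 + 2u; S = (1−2A)(1−2B) + 2A(1−2B) + 2B(1−2A)) … d′ = 3: S = 1 − 4ΣAB + 16ABC»; FLAT abelian toy, «never the NE7
estimate».  In `d′` dimensions the alias labels are `n ∈ {0,1}^{d′}`, `y_μ = sin²(p_μ∕2) ∈ [0,1]`, `A_μ = y_μ(1−y_μ) ∈ [0,¼]`, `u_n = Σ_μ (y_μ if n_μ = 0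
else 1 − y_μ)` (`ω_n = 4u_n`), `w_n = Π_μ ((1−y_μ)² if n_μ = 0 else y_μ²)` (`= |t_n|²`), and THEOREM B's weight `g_B(ω) = 2∕(2+ω)` has inverse
`1 + 2u`.  THIS FILE:
* §1 `uuD ∕ wwD ∕ AA ∕ secularSBD` and the PRODUCT STRUCTURE: **`sum_wwD`** (`Σ_n w_n = Π_μ(1 − 2A_μ)`), **`sum_wwD_mul_uuD`** (`Σ_n w_n u_n =
  Σ_μ A_μ Π_{ν≠μ}(1 − 2A_ν)`), **`secularSBD_eq`** (her three-term display, all `d′`).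
* §2 **`atMostOne_le_one`**: for `p_μ, q_μ ≥ 0` with `p_μ + q_μ = 1`, `Π_μ p_μ + Σ_μ q_μ Π_{ν≠μ} p_ν ≤ 1` (expand `1 = Π_μ(p_μ + q_μ)` over subsets
  and keep the subsets of size ≤ 1) ⇒ **`secularSBD_le_one`** on `[0,1]^{d′}` (take `q_μ = 2A_μ ≤ ½`): THEOREM B's alias-block criterion holds in
  every dimension; `secularSBD_axis` (`= 1` when all but at most one `A_μ` vanish — the axis blocks).
* §3 the displays: **`secularSBD_two`** (`= 1 − 4A₀A₁`, file 128's `S_B` in these coordinates) and **`secularSBD_three`** (`= 1 − 4(A₀A₁ + A₀A₂ + A₁A₂)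
  + 16A₀A₁A₂`, her d′ = 3 line).
The operator meaning in `d′ ≠ 2` (which tent average ∕ which forms) is NOT asserted here — this is the secular polynomial only.

HONEST FRAMING: [folklore] finite algebra (`Finset.prod_univ_sum`, `Finset.prod_add`) and one sign argument; lens 1's objects stay hers; nothing of
Bałaban's instantiated; no d = 4 gauge statement (the d = 4 toy's alias structure for 2-forms is not this one); NOT a letter move (PRICING-NE7 v56 §413);
T-50-10 honoured.  NE7 NOT PRINTED ∕ NOT PROVED; spine 0∕9; FIXED FINITE T⁴, rung (B)+1; NOT infinite volume, NOT mass gap, NOT Clay.  HONEST DEPENDENCY: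
continuum YM on T⁴ ⇐ BetaPertH ∧ nine spine estimates (0/9 proved); BetaPertH ⇐ (D1) ∧ (D4) ∧ CAP+tail; G-an2-4 gates asym, D1 and NE2/3/4.
-/

noncomputable section

open Finset

namespace Summit.QuantumFields.BalabanUV.T4Continuum.NE7EJFlatSecularBAllDim

variable {d : ℕ}

/-! ### §1 The alias data in dimension `d′` and its product structure -/

/-- alias labels `n ∈ {0,1}^{d′}`. [folklore] -/
abbrev AliasD (d : ℕ) := Fin d → Bool

/-- `u_n = Σ_μ (y_μ if n_μ = 0 else 1 − y_μ)` (`ω_n = 4u_n`). [folklore] -/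
def uuD (y : Fin d → ℝ) (n : AliasD d) : ℝ := ∑ μ, if n μ then 1 - y μ else y μ

/-- `w_n = Π_μ ((1−y_μ)² if n_μ = 0 else y_μ²)` (`= |t_n|²`). [folklore] -/
def wwD (y : Fin d → ℝ) (n : AliasD d) : ℝ := ∏ μ, if n μ then y μ ^ 2 else (1 - y μ) ^ 2

/-- `A_μ = y_μ(1 − y_μ)` (`= ¼sin²p_μ`). [folklore] -/
def AA (y : Fin d → ℝ) (μ : Fin d) : ℝ := y μ * (1 - y μ)

/-- THEOREM B's secular sum in dimension `d′`: `S_B^{(d′)} := Σ_n w_n(1 + 2u_n)`. [folklore] -/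
def secularSBD (y : Fin d → ℝ) : ℝ := ∑ n : AliasD d, wwD y n * (1 + 2 * uuD y n)

/-- `0 ≤ w_n`. [folklore] -/
theorem wwD_nonneg (y : Fin d → ℝ) (n : AliasD d) : 0 ≤ wwD y n :=
  prod_nonneg fun μ _ => by split_ifs <;> positivity

/-- the per-coordinate weights: `c_μ(b) = y_μ²` if `b`, `(1−y_μ)²` otherwise. [folklore] -/
def cw (y : Fin d → ℝ) (μ : Fin d) (b : Bool) : ℝ := if b then y μ ^ 2 else (1 - y μ) ^ 2

/-- the per-coordinate energies: `e_μ(b) = 1 − y_μ` if `b`, `y_μ` otherwise. [folklore] -/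
def ce (y : Fin d → ℝ) (μ : Fin d) (b : Bool) : ℝ := if b then 1 - y μ else y μ

/-- `Σ_b c_μ(b) = 1 − 2A_μ`. [folklore] -/
theorem sum_cw (y : Fin d → ℝ) (μ : Fin d) : ∑ b, cw y μ b = 1 - 2 * AA y μ := by
  rw [Fintype.sum_bool]; unfold cw AA; simp only [if_true, Bool.false_eq_true, if_false]; ring

/-- `Σ_b c_μ(b)·e_μ(b) = A_μ`. [folklore] -/
theorem sum_cw_mul_ce (y : Fin d → ℝ) (μ : Fin d) : ∑ b, cw y μ b * ce y μ b = AA y μ := by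
  rw [Fintype.sum_bool]; unfold cw ce AA; simp only [if_true, Bool.false_eq_true, if_false]; ring

/-- the product structure: `Σ_{n ∈ {0,1}^{d′}} Π_μ f_μ(n_μ) = Π_μ Σ_b f_μ(b)`. [folklore] -/
theorem sum_prod_eq_prod_sum (f : Fin d → Bool → ℝ) : ∑ n : AliasD d, ∏ μ, f μ (n μ) = ∏ μ, ∑ b, f μ b := by
  rw [Finset.prod_univ_sum]
  simp only [Fintype.piFinset_univ]

/-- **`Σ_n w_n = Π_μ(1 − 2A_μ)`**. [folklore] -/
theorem sum_wwD (y : Fin d → ℝ) : ∑ n : AliasD d, wwD y n = ∏ μ, (1 - 2 * AA y μ) := by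
  have h := sum_prod_eq_prod_sum (cw y)
  unfold cw at h
  unfold wwD
  rw [h]
  exact prod_congr rfl fun μ _ => sum_cw y μ

/-- one coordinate singled out: `w_n·e_μ(n_μ) = (c_μ·e_μ)(n_μ)·Π_{ν≠μ} c_ν(n_ν)`. [folklore] -/
theorem wwD_mul_ce (y : Fin d → ℝ) (n : AliasD d) (μ : Fin d) :
    wwD y n * ce y μ (n μ) = ∏ ν, (if ν = μ then cw y ν (n ν) * ce y ν (n ν) else cw y ν (n ν)) := by
  unfold wwD
  rw [← Finset.mul_prod_erase univ _ (mem_univ μ), ← Finset.mul_prod_erase univ (fun ν => if ν = μ then _ else _) (mem_univ μ)]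
  simp only [if_true]
  have e : ∏ ν ∈ univ.erase μ, (if ν = μ then cw y ν (n ν) * ce y ν (n ν) else cw y ν (n ν)) = ∏ ν ∈ univ.erase μ, cw y ν (n ν) :=
    prod_congr rfl fun ν hν => by rw [if_neg (ne_of_mem_erase hν)]
  rw [e]; unfold cw; ring

/-- **`Σ_n w_n·u_n = Σ_μ A_μ·Π_{ν≠μ}(1 − 2A_ν)`**. [folklore] -/
theorem sum_wwD_mul_uuD (y : Fin d → ℝ) : ∑ n : AliasD d, wwD y n * uuD y n = ∑ μ, AA y μ * ∏ ν ∈ univ.erase μ, (1 - 2 * AA y ν) := by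
  have huu : ∀ n : AliasD d, uuD y n = ∑ μ, ce y μ (n μ) := fun n => by unfold uuD ce; rfl
  simp_rw [huu, mul_sum]
  rw [sum_comm]
  refine sum_congr rfl fun μ _ => ?_
  simp_rw [wwD_mul_ce y _ μ]
  have hps := sum_prod_eq_prod_sum (fun ν b => if ν = μ then cw y ν b * ce y ν b else cw y ν b)
  rw [hps]
  rw [← Finset.mul_prod_erase univ _ (mem_univ μ)]
  simp only [if_true]
  rw [sum_cw_mul_ce]
  congr 1
  exact prod_congr rfl fun ν hν => by
    rw [show (∑ b, if ν = μ then cw y ν b * ce y ν b else cw y ν b) = ∑ b, cw y ν b from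
      sum_congr rfl fun b _ => by rw [if_neg (ne_of_mem_erase hν)], sum_cw]

/-- **THEOREM B's secular sum in every dimension** (lens 1's display `S = (1−2A)(1−2B) + 2A(1−2B) + 2B(1−2A)` for general `d′`):
`S_B^{(d′)} = Π_μ(1 − 2A_μ) + 2Σ_μ A_μ Π_{ν≠μ}(1 − 2A_ν)`. [folklore] -/
theorem secularSBD_eq (y : Fin d → ℝ) :
    secularSBD y = ∏ μ, (1 - 2 * AA y μ) + 2 * ∑ μ, AA y μ * ∏ ν ∈ univ.erase μ, (1 - 2 * AA y ν) := by
  unfold secularSBD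
  have e : ∀ n : AliasD d, wwD y n * (1 + 2 * uuD y n) = wwD y n + 2 * (wwD y n * uuD y n) := fun n => by ring
  simp_rw [e]
  rw [sum_add_distrib, ← mul_sum, sum_wwD, sum_wwD_mul_uuD]

/-! ### §2 «At most one failure»: the bound `S_B^{(d′)} ≤ 1` -/

/-- **AT MOST ONE FAILURE**: for `p_μ, q_μ ≥ 0` with `p_μ + q_μ = 1`, `Π_μ p_μ + Σ_μ q_μ·Π_{ν≠μ} p_ν ≤ 1` — the two terms are the subsets of size
`0` and `1` in the expansion `1 = Π_μ(p_μ + q_μ) = Σ_{T} Π_{μ∈T} q_μ·Π_{ν∉T} p_ν`, all of whose terms are `≥ 0`. [folklore] -/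
theorem atMostOne_le_one {p q : Fin d → ℝ} (hp : ∀ μ, 0 ≤ p μ) (hq : ∀ μ, 0 ≤ q μ) (h1 : ∀ μ, p μ + q μ = 1) :
    ∏ μ, p μ + ∑ μ, q μ * ∏ ν ∈ univ.erase μ, p ν ≤ 1 := by
  classical
  have hone : (1 : ℝ) = ∏ μ : Fin d, (q μ + p μ) := by
    rw [eq_comm]; exact prod_eq_one fun μ _ => by rw [add_comm]; exact h1 μ
  rw [hone, Finset.prod_add]
  -- the expansion over subsets T ⊆ univ: Σ_T (Π_{T} q)(Π_{univ \ T} p); keep T = ∅ and the singletons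
  have hterm : ∀ T ∈ (univ : Finset (Fin d)).powerset, 0 ≤ (∏ μ ∈ T, q μ) * ∏ ν ∈ univ \ T, p ν :=
    fun T _ => mul_nonneg (prod_nonneg fun μ _ => hq μ) (prod_nonneg fun ν _ => hp ν)
  let S : Finset (Finset (Fin d)) := insert ∅ (univ.image fun μ => ({μ} : Finset (Fin d)))
  have hS : S ⊆ (univ : Finset (Fin d)).powerset := fun T _ => mem_powerset.mpr (subset_univ T)
  have hle := Finset.sum_le_sum_of_subset_of_nonneg hS (fun T hT _ => hterm T hT)
  refine le_trans (le_of_eq ?_) hle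
  -- evaluate the sum over S = {∅} ∪ {{μ}}
  have hnot : (∅ : Finset (Fin d)) ∉ univ.image fun μ => ({μ} : Finset (Fin d)) := by
    simp only [mem_image, mem_univ, true_and, not_exists]
    intro μ h; exact absurd h (singleton_ne_empty μ)
  rw [Finset.sum_insert hnot, Finset.sum_image (fun μ _ ν _ h => singleton_injective h)]
  simp only [prod_empty, one_mul, sdiff_empty, prod_singleton]
  congr 1
  exact sum_congr rfl fun μ _ => by rw [Finset.sdiff_singleton_eq_erase]

/-- `0 ≤ A_μ ≤ ¼` on `[0,1]`. [folklore] -/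
theorem AA_mem {y : Fin d → ℝ} (hy : ∀ μ, y μ ∈ Set.Icc (0:ℝ) 1) (μ : Fin d) : 0 ≤ AA y μ ∧ AA y μ ≤ 1 / 4 := by
  obtain ⟨h0, h1⟩ := hy μ
  unfold AA
  exact ⟨mul_nonneg h0 (by linarith), by nlinarith [sq_nonneg (y μ - 1 / 2)]⟩

/-- **THEOREM B's CRITERION IN EVERY DIMENSION**: `S_B^{(d′)} ≤ 1` on `[0,1]^{d′}`. [folklore] -/
theorem secularSBD_le_one {y : Fin d → ℝ} (hy : ∀ μ, y μ ∈ Set.Icc (0:ℝ) 1) : secularSBD y ≤ 1 := by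
  rw [secularSBD_eq]
  have h := atMostOne_le_one (p := fun μ => 1 - 2 * AA y μ) (q := fun μ => 2 * AA y μ)
    (fun μ => by linarith [(AA_mem hy μ).2]) (fun μ => by linarith [(AA_mem hy μ).1]) (fun μ => by ring)
  have e : ∑ μ, 2 * AA y μ * ∏ ν ∈ univ.erase μ, (1 - 2 * AA y ν) = 2 * ∑ μ, AA y μ * ∏ ν ∈ univ.erase μ, (1 - 2 * AA y ν) := by
    rw [mul_sum]; exact sum_congr rfl fun μ _ => by ring
  rw [e] at h
  exact h

/-- `0 ≤ S_B^{(d′)}` on `[0,1]^{d′}` (non-negative weights and energies). [folklore] -/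
theorem secularSBD_nonneg {y : Fin d → ℝ} (hy : ∀ μ, y μ ∈ Set.Icc (0:ℝ) 1) : 0 ≤ secularSBD y := by
  unfold secularSBD
  refine sum_nonneg fun n _ => mul_nonneg (wwD_nonneg y n) ?_
  have : 0 ≤ uuD y n := by
    unfold uuD
    exact sum_nonneg fun μ _ => by obtain ⟨h0, h1⟩ := hy μ; split_ifs <;> linarith
  linarith

/-- **the axis blocks saturate**: if all but at most one `A_μ` vanish (say all `μ ≠ μ₀`), then `S_B^{(d′)} = 1`. [folklore] -/
theorem secularSBD_axis (y : Fin d → ℝ) (μ₀ : Fin d) (h : ∀ μ, μ ≠ μ₀ → AA y μ = 0) : secularSBD y = 1 := by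
  rw [secularSBD_eq]
  have hprod : ∏ μ, (1 - 2 * AA y μ) = 1 - 2 * AA y μ₀ := by
    rw [← Finset.mul_prod_erase univ _ (mem_univ μ₀)]
    rw [prod_eq_one fun ν hν => by rw [h ν (ne_of_mem_erase hν)]; ring]
    ring
  have hsum : ∑ μ, AA y μ * ∏ ν ∈ univ.erase μ, (1 - 2 * AA y ν) = AA y μ₀ := by
    rw [← Finset.add_sum_erase univ _ (mem_univ μ₀)]
    rw [prod_eq_one fun ν hν => by rw [h ν (ne_of_mem_erase hν)]; ring, mul_one]
    rw [sum_eq_zero fun μ hμ => by rw [h μ (ne_of_mem_erase hμ), zero_mul], add_zero]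
  rw [hprod, hsum]; ring

/-! ### §3 The `d′ = 2` and `d′ = 3` displays -/

/-- `d′ = 2`: `S_B^{(2)} = 1 − 4A₀A₁` (file 128's `S_B = 1 − 4AB` in these coordinates). [folklore] -/
theorem secularSBD_two (y : Fin 2 → ℝ) : secularSBD y = 1 - 4 * AA y 0 * AA y 1 := by
  rw [secularSBD_eq, Fin.prod_univ_two, Fin.sum_univ_two]
  have e0 : (univ : Finset (Fin 2)).erase 0 = {1} := by decide
  have e1 : (univ : Finset (Fin 2)).erase 1 = {0} := by decide
  rw [e0, e1, prod_singleton, prod_singleton]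
  ring

/-- `d′ = 3` (lens 1's display): `S_B^{(3)} = 1 − 4(A₀A₁ + A₀A₂ + A₁A₂) + 16A₀A₁A₂`. [folklore] -/
theorem secularSBD_three (y : Fin 3 → ℝ) :
    secularSBD y = 1 - 4 * (AA y 0 * AA y 1 + AA y 0 * AA y 2 + AA y 1 * AA y 2) + 16 * AA y 0 * AA y 1 * AA y 2 := by
  rw [secularSBD_eq, Fin.prod_univ_three, Fin.sum_univ_three]
  have e0 : (univ : Finset (Fin 3)).erase 0 = {1, 2} := by decide
  have e1 : (univ : Finset (Fin 3)).erase 1 = {0, 2} := by decide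
  have e2 : (univ : Finset (Fin 3)).erase 2 = {0, 1} := by decide
  rw [e0, e1, e2, prod_pair (by decide), prod_pair (by decide), prod_pair (by decide)]
  ring

end Summit.QuantumFields.BalabanUV.T4Continuum.NE7EJFlatSecularBAllDim

end

-- Build-lane re-trigger (lineage t4-ne7-p2, gen 85, 2026-08-24): comment-only re-land of the tree bytes 1f8fe07dc24f44c2 (file 134, p375627, gen 82);
-- every declaration byte-identical.  Never built (`ops/buildfix/UNBUILT-ACCEPTED-20260824T1600.txt` l.534: last build event rc 75 NO-HOST, attempt 64).
-- Cf. ops-buildfix-2's comment-only re-land p372431 of `B7Prop4Flat`.
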